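import Literature.Probability.Percolation.VerticalTransportGM
import HarnessLib

/-!
# Transport of vertical crossings: the statement for `P_{α,ξ} → P_{α,β}` (Prop. 6.8)

Grimmett–Manolescu, *Bond percolation on isoradial graphs* (PTRF 159 (2014) 273–327 =
arXiv:1204.0505), §6.2–§6.3. The transports `HData.horizontal_transport_gm` (Prop. 6.4) and
`VData.vertical_transport_gm` (Prop. 6.8) were proved for the *strip* lattices: the source
measure has the regular angle `ξ` on the rows `0 … N-1` (and other rows elsewhere), the target
has `β_0, …, β_{K-1}` on the rows `0 … K-1`. Since their events only look at edges between the
heights where the rows agree with the homogeneous lattices `G_{α,ξ}` resp. `G_{α,β}`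
("`B(N, N)` lies entirely in the regular block of `G^0`", "`B(4N, δN)` lies in the irregular
section of `G^N`", §6.3; similarly §6.2), the same inequalities hold for the honest measures
`P_{α,ξ} = prodBernoulli (gmWeight α (fun _ => ξ))` and `P_{α,β} = prodBernoulli (gmWeight α β)`.
This file proves that passage:

* `measurableSet_setOf_isLatticeWalk` and the measurability of the four events;
* `determinedBy_…` — each event is determined by the edges between its heights
  (`PercolationEvents.DeterminedBy`), and `gmWeight_eq_of_rows` — `gmWeight α rows e` depends on
  `rows` only through the row of `e`; whence `prodBernoulli_real_eq_of_determinedBy`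
  (`ProdBernoulliClusterLocality`) exchanges the measures;
* **`horizontal_transport`** (Prop. 6.4) and **`vertical_transport`** (Prop. 6.8) for
  `P_{α,ξ} → P_{α,β}`, uniformly over all `α, β, ξ` with `ξ - α_i, β_j - α_i ∈ [ε, π - ε]`.

## References

* G. R. Grimmett, I. Manolescu, PTRF 159 (2014) 273–327, arXiv:1204.0505, §6.2 (Prop. 6.4),
  §6.3 (Prop. 6.8).
-/

noncomputable section

namespace Literature.Probability.Percolation

open LatticeModels StarTriangle Real MeasureTheory Complex

namespace TrackExchange

/-! ### The transports for the honest measures -/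

/-- **Proposition 6.8 for `P_{α,ξ} → P_{α,β}`.** For `0 < ε`, all `N ≥ 1`, `u ≤ θ(ε)N/2` and
all `α, β, ξ` with `ξ - α_i, β_j - α_i ∈ [ε, π - ε]`:
`(θ(ε)/2) · P_{α,ξ}(C_v[B(N, N)]) ≤ P_{α,β}(cvFinalGM N u)`. [cite: GrimmettManolescu2014Isoradial, §6.3 Proposition 6.8] -/
theorem vertical_transport {ε : ℝ} (hε : 0 < ε) {N : ℕ} (hN : 1 ≤ N) {u : ℕ}
    (hu : (u : ℝ) ≤ VData.θ ε * N / 2) (α β : ℤ → ℝ) (ξ : ℝ) (hξ : AnglesIn ε α (fun _ => ξ)) (hβ : AnglesIn ε α β) :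
    VData.θ ε / 2 * (prodBernoulli (Percolation.gmWeight α fun _ => ξ)).real (cvInitGM N) ≤
      (prodBernoulli (Percolation.gmWeight α β)).real (cvFinalGM N u) := by
  let V : VData := ⟨4 * N + 4, α, fun k => β k, ξ, N⟩
  have hV : V.Valid ε :=
    { ε_pos := hε, M_pos := by show 0 < 4 * N + 4; omega, N_pos := hN
      ξα := fun i _ _ => hξ i 0, βα := fun k i _ _ => hβ i k }
  have key := VData.vertical_transport_gm (V := V) hV (le_refl _) hu
  obtain ⟨hθ0, hθ1⟩ := VData.θ_pos_le hε hV.ε_lt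
  have huN : (u : ℤ) ≤ N := by
    have : (u : ℝ) ≤ N := hu.trans (by nlinarith [(Nat.cast_nonneg N : (0 : ℝ) ≤ N)])
    exact_mod_cast this
  -- exchange the measures
  have e1 : (prodBernoulli (Percolation.gmWeight V.α (V.rowV 0 0))).real (cvInitGM N) =
      (prodBernoulli (Percolation.gmWeight α fun _ => ξ)).real (cvInitGM N) :=
    prodBernoulli_real_eq_of_determinedBy _ _ (gmWeight_eq_of_rows α (fun j hj hjN => by
      show VData.rowV ⟨4 * N + 4, α, fun k => β k, ξ, N⟩ 0 0 j = ξ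
      unfold VData.rowV
      dsimp only
      push_cast
      split_ifs with h1 h2 h3 h4 <;> first | rfl | (exfalso; omega)))
      (determinedBy_cvInitGM N) (measurableSet_cvInitGM N)
  have e2 : (prodBernoulli (Percolation.gmWeight V.α (V.rowV V.N 0))).real (cvFinalGM N u) =
      (prodBernoulli (Percolation.gmWeight α β)).real (cvFinalGM N u) :=
    prodBernoulli_real_eq_of_determinedBy _ _ (gmWeight_eq_of_rows α (fun j hj hju => by
      show VData.rowV ⟨4 * N + 4, α, fun k => β k, ξ, N⟩ N 0 j = β j
      unfold VData.rowV
      dsimp only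
      have hjN : j < (N : ℤ) := by omega
      push_cast
      split_ifs with h1 h2 h3 h4 <;> first
        | (exfalso; omega)
        | (congr 1; rw [sub_self, sub_zero, Int.toNat_of_nonneg hj])))
      (determinedBy_cvFinalGM N u) (measurableSet_cvFinalGM N u)
  have hfin : prodBernoulli (Percolation.gmWeight V.α (V.rowV V.N 0)) (cvFinalGM V.N u) ≠ ⊤ := measure_ne_top _ _
  have := ENNReal.toReal_mono hfin key
  rw [ENNReal.toReal_mul, ENNReal.toReal_ofReal (by linarith)] at this
  rw [← e1, ← e2]
  exact this

end TrackExchange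

end Literature.Probability.Percolation
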